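import Summits.BirchSwinnertonDyer.Rank1Residual.Additive.X4SharpThreeAssemblyManinFreeNoLemma20
import Summits.BirchSwinnertonDyer.Rank1Residual.Additive.N10IsogenyTransport
import Summits.BirchSwinnertonDyer.Rank1Residual.Supersingular.DescentLowerBound
import HarnessLib

/-!
# Route `AdditiveBranchIMC` (rung K1), crux `GordTwoRankZeroOffCaseOne` (item 19357): the rank-ZERO `3`-DESCENT door, X4♯(3) form —
# MANIN-FREE / `hL20`-FREE twin of `…Desc3Door` §2 (cell `bsd-addord`, seat `bsd-addord-k1-c2` gen 7; director-bsd g8 ROUTING WORD 2026-08-27T09:53:41Z (iii):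
# «Manin-free twin preferred as the closer» for the planner's W-ALL row-2 @3 r0 table offer of the 2 100 U(s = 2) W / T′ / Gss2 classes)

HONEST FRAMING. THEOREMS ONLY: no definition, no named fact, no `sorry`, nothing booked; BSD is not proved by any of this; the crux stays OPEN at
class level. Pure composition: team n1011 p05's `X4RankZero.bsdp_three_of_cert_of_lower_maninFree_noL20` (UPPER half on X4♯(3): (M) branch
Delbourgo 1998 Prop. 4 `hDel` + Kato's `ω`-component divisibility `hKatoω`; potentially good branch Kato 2004 Thm. 14.5 (3) in the Manin-free
local-Tamagawa reading `hKato` under `3 ∤ ∏ c_ℓ` and a `3`-adic image certificate [`ord₃ j < 0` ∨ `j`-witness ∨ surj(9)]; Wuthrich's Lemma 20 is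
the tree theorem `…_holds`, so no `hL20` binder; NO modular-parametrisation / Manin datum) fed with the class-free LOWER half from the native
`3`-descent certificate `Sel^(3)(E/ℚ) ≠ 0` (`Supersingular.missingLowerBoundAt_of_casselsTate_of_selmerGroup_ne_bot`: rank `0` by GZK, `E[3]`
irreducible ⟹ no rational `3`-torsion, Cassels–Tate `hCT` ⟹ `9 ∣ #Ш`). A separate module (not an append to `…Desc3Door`) so that the 180+ record
modules importing `…Desc3Door` are not rebuilt. Per pair; the rows it serves (KUR3-COVERAGE-v1 cell U(s = 2), sub-blocks W / T′ / Gss2: table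
`HOME/k1-c2/g7/DESC3-WTG-U2-certs-g7.tsv`, certificates kit j275145) are offered BY NAME by the planner (V20X grammar); nothing of bsd-potss's is
restated. References: [Kato2004Asterisque] Thm. 14.5 (3) (p. 236), Thm. 17.4 (3) (p. 273); [Delbourgo1998] Prop. 4 (p. 144); [Wuthrich2014] Lemma 20
(p. 399); [SilvermanAEC2009] Thm. X.4.2(a), X.4.14; [MilneADT2006] Thm. I.7.3; [Miller2011LMS] Def. 1.1; [SchaeferStoll2004].
-/

noncomputable section

open scoped Classical

open WeierstrassCurve Literature.NumberTheory.EllipticCurves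
  Literature.NumberTheory.EllipticCurves.ModularForms
  Literature.NumberTheory.EllipticCurves.Rank1Residual
  Literature.NumberTheory.EllipticCurves.Rank1Residual.Typed
  Literature.NumberTheory.GaloisRepresentations

set_option linter.dupNamespace false
set_option autoImplicit false

namespace Summit.BirchSwinnertonDyer.BirchSwinnertonDyer.Theorems.AdditiveBranchIMCGordTwoRankZeroDesc3

open Summit.BirchSwinnertonDyer.Rank1Residual
open Summit.BirchSwinnertonDyer.Rank1Residual.Additive

/-! ### The X4♯(3) form WITHOUT the Manin datum and WITHOUT the `hL20` binder -/

section X4SharpThreeManinFree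

variable (W : WeierstrassCurve ℚ) [W.IsElliptic] [W.IsGloballyMinimal]

/-- **`BSD(E,3)` on an X4♯(3) row with `ord₃ #Ш_an ≤ 2` from the certificate line `Sel^(3)(E/ℚ) ≠ 0` — MANIN-FREE, `hL20`-FREE form**:
binders {hKato (Manin-free reading), hDel, hGZK, hmod, hmodD, hKatoω, hCT} + row data (`ClassX4 W 3`, surj(3), the `3`-adic image certificate
[`ord₃ j < 0` ∨ `j`-witness ∨ surj(9)], `3 ∤ ∏ c_ℓ`, `#Ш_an = q` with `ord₃ q ≤ 2`) + `hSel`. For the W / T′ / Gss2 sub-blocks of the planner's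
U(s = 2) cell (KUR3-COVERAGE-v1 §2 (R2)); per pair; nothing booked here. [cite: Kato2004Asterisque, Thm. 14.5 (3) (p. 236), Thm. 17.4 (3) (p. 273)]
[cite: Delbourgo1998, Prop. 4 (p. 144)] [cite: Wuthrich2014, Lemma 20 (p. 399)] [cite: SilvermanAEC2009, Thm. X.4.14] [cite: Miller2011LMS, §1 and Def. 1.1] -/
theorem bsdp_three_of_x4Cert_of_selmerGroup_ne_bot_maninFree
    (hKato : Kato2004.rankZero_padicValNat_sha_le_sub_localTamagawa_of_additive_potGood_of_imageContainsSL2_maninFree)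
    (hDel : Delbourgo1998.prop4_rankZero_pow_dvd_constantCoeff)
    (hGZK : rank_eq_analyticRank_of_analyticRank_le_one) (hmod : hasEntireLFunction_rat)
    (hmodD : nonempty_modularParametrizationData)
    (hKatoω : Wuthrich2014.kato_minusEigenCharIdeal_dvd_cyclotomicThree_of_surjective)
    (hCT : exists_casselsTate_pairing (K := ℚ))
    (hr : W.analyticRank = 0) (hX : ClassX4 W 3) (hsurj : Surj W 3)
    (hcert : padicValRat 3 W.j < 0 ∨
      (∃ q : ℕ, q.Prime ∧ q ≠ 3 ∧ padicValRat q W.j < 0 ∧ ¬ (3 : ℤ) ∣ padicValRat q W.j) ∨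
        W.HasSurjectiveModNGaloisRep 9)
    (htam : ¬ 3 ∣ W.tamagawaProduct)
    {q : ℚ} (hq : shaAn W = (q : ℂ)) (hv : padicValRat 3 q ≤ 2) (hSel : W.selmerGroup (3 : ℤ) ≠ ⊥) : BSDp W 3 :=
  haveI : Fact (Nat.Prime 3) := ⟨Nat.prime_three⟩
  X4RankZero.bsdp_three_of_cert_of_lower_maninFree_noL20 W hKato hDel hGZK hmod hmodD hKatoω hr hX hsurj hcert htam
    (Supersingular.missingLowerBoundAt_of_casselsTate_of_selmerGroup_ne_bot W 3 hCT hGZK hr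
      (Supersingular.not_dvd_torsionOrder_of_irr W 3 hX.2.2) hq hv hSel)

/-- **ISOGENY-CLASS form of the Manin-free X4♯(3) certificate door** (Cassels `hCassels`).
[cite: MilneADT2006, Thm. I.7.3 and Remark I.7.4] [cite: Kato2004Asterisque, Thm. 14.5 (3) (p. 236)] [cite: SilvermanAEC2009, Thm. X.4.14]
[cite: Miller2011LMS, §1 and Def. 1.1] -/
theorem isogenous_bsdp_three_of_x4Cert_of_selmerGroup_ne_bot_maninFree
    (hCassels : bsdRHS_eq_of_isIsogenous)
    (hKato : Kato2004.rankZero_padicValNat_sha_le_sub_localTamagawa_of_additive_potGood_of_imageContainsSL2_maninFree)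
    (hDel : Delbourgo1998.prop4_rankZero_pow_dvd_constantCoeff)
    (hGZK : rank_eq_analyticRank_of_analyticRank_le_one) (hmod : hasEntireLFunction_rat)
    (hmodD : nonempty_modularParametrizationData)
    (hKatoω : Wuthrich2014.kato_minusEigenCharIdeal_dvd_cyclotomicThree_of_surjective)
    (hCT : exists_casselsTate_pairing (K := ℚ))
    {W' : WeierstrassCurve ℚ} [W'.IsElliptic] [W'.IsGloballyMinimal] (hiso : IsIsogenous W' W)
    (hr : W.analyticRank = 0) (hX : ClassX4 W 3) (hsurj : Surj W 3)
    (hcert : padicValRat 3 W.j < 0 ∨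
      (∃ q : ℕ, q.Prime ∧ q ≠ 3 ∧ padicValRat q W.j < 0 ∧ ¬ (3 : ℤ) ∣ padicValRat q W.j) ∨
        W.HasSurjectiveModNGaloisRep 9)
    (htam : ¬ 3 ∣ W.tamagawaProduct)
    {q : ℚ} (hq : shaAn W = (q : ℂ)) (hv : padicValRat 3 q ≤ 2) (hSel : W.selmerGroup (3 : ℤ) ≠ ⊥) : BSDp W' 3 := by
  haveI : Fact (Nat.Prime 3) := ⟨Nat.prime_three⟩
  have hr' : W'.analyticRank ≤ 1 := by rw [analyticRank_eq_of_isIsogenous' hiso, hr]; exact zero_le_one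
  exact N10.bsdp_of_isIsogenous_of_bsdp 3 hCassels hGZK hmod hiso hr'
    (bsdp_three_of_x4Cert_of_selmerGroup_ne_bot_maninFree W hKato hDel hGZK hmod hmodD hKatoω hCT hr hX hsurj hcert htam hq hv hSel)

end X4SharpThreeManinFree

end Summit.BirchSwinnertonDyer.BirchSwinnertonDyer.Theorems.AdditiveBranchIMCGordTwoRankZeroDesc3

end
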